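import Literature.NumberTheory.Irrationality.Zudilin2004.GeneralOddZetaForms
import Literature.NumberTheory.Transcendental.ReciprocalBricks
import HarnessLib

/-!
# Zudilin 2004, Lemma 19 for general `𝐡`, I: the rational function as a product of bricks, (8.10)

Topic `Literature/NumberTheory/Irrationality/Zudilin2004`. First file of the DISCHARGE of the named fact
`Literature.NumberTheory.Irrationality.Zudilin2004.lemma19` (`GeneralOddZetaForms.lean`), following the printed
proof of [Zudilin2004, Lemma 19] (arXiv:math/0206176, §7 Lemmas 15–16 p. 17, §8 (8.7)–(8.10) pp. 19–20).
For a parameter set `P = (q, r, 𝐡)` (`HParams`) we prove: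

* consequences of the standing hypotheses `HParams.Valid` (`h` monotone on `1,…,q`, `2h_j < h₀`, `q − r` even);
* `HParams.RwpQ` — the rational function `R(t)` of (8.6)–(8.7) (with the well-poised factor `h₀ + 2t`) over `ℚ`,
  `HParams.cast_RwpQ : (RwpQ P t : ℝ) = Rwp P t`;
* `HParams.RwpQ_eq_bricks` — the factorisation of (8.7) into Nesterenko's elementary bricks (7.3):
  `R(t) = (h₀+2t) · ∏_{j≤r} R(h_j,1;t) · ∏_{j≤r} R(h₀,h₀−h_j+1;t) · ∏_{j>r} R(h_j,h₀−h_j+1;t)`, i.e.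
  `polyBrick 1 (h_j−1)`, `polyBrick (h₀−h_j+1) (h_j−1)`, `recipBrick h_j (h₀−2h_j+1)`;
* `HParams.Gk P k` — the product `R(t)(t+k)^{q−r}` with its removable singularity at `t = −k` removed (each of the
  `q − r` reciprocal bricks absorbs one factor `t + k`, `recipBrickReg`), `HParams.Gk_eq` away from `t = −k`;
* `HParams.Gk_isDInt` — **(8.10)**: for `h_{r+1} ≤ k ≤ h₀ − h_{r+1}` and every `N`,
  `D_{m₀}^j · (1/j!) (R(t)(t+k)^{q−r})^{(j)}|_{t=−k} ∈ ℤ` (`j ≤ N`), `m₀ = max{h_r − 1, h₀ − 2h_{r+1}}`, by the Leibniz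
  rule from Lemma 15 (`polyBrick_isDInt_neg`, moduli `D_{h_j−1} ∣ D_{m₀}`) and Lemma 16 (`recipBrickReg_isDInt`
  with `a₀ = h_{r+1}`, `b₀ = h₀ − h_{r+1} + 1`, modulus `D_{h₀−2h_{r+1}} ∣ D_{m₀}`).

Everything here is PROVED (no named facts, D-0026).

## References

* [Zudilin2004] W. Zudilin, *Arithmetic of linear forms involving odd zeta values*, J. Théor. Nombres Bordeaux
  16 (2004), 251–291 = arXiv:math/0206176, §7 (7.3), Lemmas 15–16; §8 (8.6)–(8.7), (8.10).
-/

noncomputable section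

open Finset Filter Literature.Analysis.Calculus
open scoped Nat

namespace Literature.NumberTheory.Irrationality.Zudilin2004

open Literature.NumberTheory.Transcendental

namespace HParams

/-! ### Consequences of the standing hypotheses -/

section Valid

variable {P : HParams}

/-- `r ≥ 1` (it is odd). [cite: Zudilin2004, §8 (8.1)] -/
theorem Valid.one_le_r (hV : P.Valid) : 1 ≤ P.r := by
  obtain ⟨-, hr, -⟩ := hV
  exact hr.pos

/-- `r + 4 ≤ q`. [cite: Zudilin2004, §8 (8.1)] -/
theorem Valid.r_add_four_le (hV : P.Valid) : P.r + 4 ≤ P.q := hV.2.2.1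

/-- `h_j ≥ 1` for `j ≤ q`. [cite: Zudilin2004, §8 (8.1)] -/
theorem Valid.one_le_h (hV : P.Valid) {j : ℕ} (hj : j ≤ P.q) : 1 ≤ P.h j :=
  hV.2.2.2.1 j (mem_Icc.2 ⟨Nat.zero_le _, hj⟩)

/-- (8.1): `2(h₁ + ⋯ + h_q) ≤ h₀ (q − r)`. [cite: Zudilin2004, §8 (8.1)] -/
theorem Valid.two_mul_sum_le (hV : P.Valid) : 2 * (∑ j ∈ Icc 1 P.q, P.h j) ≤ P.h 0 * (P.q - P.r) :=
  hV.2.2.2.2.1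

/-- `h_j ≤ h_{j+1}` (`1 ≤ j < q`). [cite: Zudilin2004, §8 (ordering before (8.6))] -/
theorem Valid.h_le_succ (hV : P.Valid) {j : ℕ} (hj : 1 ≤ j) (hj' : j + 1 ≤ P.q) : P.h j ≤ P.h (j + 1) :=
  hV.2.2.2.2.2.1 j (mem_Icc.2 ⟨hj, by omega⟩)

/-- The ordering `h₁ ≤ h₂ ≤ ⋯ ≤ h_q`: `h_i ≤ h_j` for `1 ≤ i ≤ j ≤ q`. [cite: Zudilin2004, §8 (ordering before (8.6))] -/
theorem Valid.h_mono (hV : P.Valid) {i j : ℕ} (hi : 1 ≤ i) (hij : i ≤ j) (hj : j ≤ P.q) : P.h i ≤ P.h j := by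
  induction j, hij using Nat.le_induction with
  | base => exact le_rfl
  | succ j hij ih => exact (ih (by omega)).trans (hV.h_le_succ (by omega) hj)

/-- `2h_j < h₀` for `1 ≤ j ≤ q` (from `h_j ≤ h_q < h₀/2`). [cite: Zudilin2004, §8 (ordering before (8.6))] -/
theorem Valid.two_mul_h_lt (hV : P.Valid) {j : ℕ} (hj : 1 ≤ j) (hj' : j ≤ P.q) : 2 * P.h j < P.h 0 := by
  have h1 := hV.h_mono hj hj' le_rfl
  have h2 := hV.2.2.2.2.2.2
  omega

/-- `q − r` is even (both are odd). [cite: Zudilin2004, §8 (8.1)] -/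
theorem Valid.even_q_sub_r (hV : P.Valid) : Even (P.q - P.r) := by
  obtain ⟨hq, hr, -⟩ := hV
  exact Nat.Odd.sub_odd hq hr

/-- `r − 1` is even. [cite: Zudilin2004, §8 (8.1)] -/
theorem Valid.even_r_sub_one (hV : P.Valid) : Even (P.r - 1) := by
  obtain ⟨-, hr, -⟩ := hV
  exact Nat.Odd.sub_odd hr odd_one

end Valid

variable (P : HParams)

/-! ### The rational function over `ℚ` -/

/-- The rational function `R(t)` of (8.6)–(8.7) (with the well-poised factor `h₀ + 2t`), over `ℚ`: the same
expression as `HParams.Rwp`. [cite: Zudilin2004, §8 (8.2), (8.6)–(8.7)] -/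
def RwpQ (t : ℚ) : ℚ :=
  ((P.h 0 : ℚ) + 2 * t) *
    (∏ j ∈ Icc 1 P.r, (∏ i ∈ Icc 1 (P.h j - 1), (t + i)) / ((P.h j - 1)! : ℚ)) *
    (∏ j ∈ Icc 1 P.r,
      (∏ i ∈ Icc 1 (P.h j - 1), (t + ((P.h 0 - P.h j : ℕ) : ℚ) + i)) / ((P.h j - 1)! : ℚ)) *
    ∏ j ∈ Icc (P.r + 1) P.q,
      ((P.h 0 - 2 * P.h j)! : ℚ) / ∏ i ∈ Icc 0 (P.h 0 - 2 * P.h j), (t + P.h j + i)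

/-- `(R(t) : ℝ) = Rwp P t` for rational `t`. [cite: Zudilin2004, §8 (8.7)] -/
theorem cast_RwpQ (t : ℚ) : ((P.RwpQ t : ℚ) : ℝ) = P.Rwp t := by
  unfold RwpQ Rwp
  push_cast
  ring

/-- `∏_{i=1}^{m} (t + c + i) = ∏_{l<m} (t + (c+1) + l)`. [folklore] -/
private theorem prod_Icc_one_eq (m : ℕ) (t c : ℚ) :
    ∏ i ∈ Icc 1 m, (t + c + i) = ∏ l ∈ range m, (t + (c + 1) + l) := by
  rw [show Icc 1 m = Ico 1 (m + 1) by rfl, prod_Ico_eq_prod_range, Nat.add_sub_cancel]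
  refine prod_congr rfl fun l _ => ?_
  push_cast
  ring

/-- **`R(t)` as a product of bricks** ([Zudilin2004, (8.7) × the factor `h₀ + 2t` of (8.2)]):
`R(t) = (h₀+2t) · ∏_{j≤r} polyBrick 1 (h_j−1) t · ∏_{j≤r} polyBrick (h₀−h_j+1) (h_j−1) t ·
∏_{j>r} recipBrick h_j (h₀−2h_j+1) t`, i.e. `Γ(h_j+t)/((h_j−1)!Γ(1+t)) = R(h_j,1;t)`,
`Γ(h₀+t)/((h_j−1)!Γ(1+h₀−h_j+t)) = R(h₀,h₀−h_j+1;t)`, `(h₀−2h_j)!Γ(h_j+t)/Γ(1+h₀−h_j+t) = R(h_j,h₀−h_j+1;t)`.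
[cite: Zudilin2004, §8 (8.7)] -/
theorem RwpQ_eq_bricks (t : ℚ) : P.RwpQ t = ((P.h 0 : ℚ) + 2 * t) *
    (∏ j ∈ Icc 1 P.r, polyBrick 1 (P.h j - 1) t) *
    (∏ j ∈ Icc 1 P.r, polyBrick ((P.h 0 - P.h j + 1 : ℕ) : ℤ) (P.h j - 1) t) *
    ∏ j ∈ Icc (P.r + 1) P.q, recipBrick (P.h j : ℤ) (P.h 0 - 2 * P.h j + 1) t := by
  have hA : ∀ j ∈ Icc 1 P.r, (∏ i ∈ Icc 1 (P.h j - 1), (t + i)) / ((P.h j - 1)! : ℚ)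
      = polyBrick 1 (P.h j - 1) t := by
    intro j _
    unfold polyBrick
    congr 1
    have := prod_Icc_one_eq (P.h j - 1) t 0
    rw [add_zero] at this
    simpa using this
  have hB : ∀ j ∈ Icc 1 P.r,
      (∏ i ∈ Icc 1 (P.h j - 1), (t + ((P.h 0 - P.h j : ℕ) : ℚ) + i)) / ((P.h j - 1)! : ℚ)
        = polyBrick ((P.h 0 - P.h j + 1 : ℕ) : ℤ) (P.h j - 1) t := by
    intro j _
    unfold polyBrick
    congr 1
    rw [prod_Icc_one_eq]
    refine prod_congr rfl fun l _ => ?_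
    push_cast
    ring
  have hC : ∀ j ∈ Icc (P.r + 1) P.q,
      ((P.h 0 - 2 * P.h j)! : ℚ) / ∏ i ∈ Icc 0 (P.h 0 - 2 * P.h j), (t + P.h j + i)
        = recipBrick (P.h j : ℤ) (P.h 0 - 2 * P.h j + 1) t := by
    intro j _
    unfold recipBrick
    rw [Nat.add_sub_cancel, div_eq_mul_inv, ← prod_inv_distrib,
      show Icc 0 (P.h 0 - 2 * P.h j) = range (P.h 0 - 2 * P.h j + 1) by ext x; simp]
    congr 1
    refine prod_congr rfl fun l _ => ?_
    push_cast
    ring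
  unfold RwpQ
  rw [prod_congr rfl hA, prod_congr rfl hB, prod_congr rfl hC]

/-! ### Regularisation at a pole -/

/-- `Gk P k t`: the product `R(t)(t+k)^{q−r}` of the proof of Lemma 19, written as a product of bricks in which
each of the `q − r` reciprocal bricks has absorbed one factor `t + k` (`recipBrickReg`), so that it is regular
at `t = −k`; its divided derivatives at `−k` are the coefficients
`B_{jk} = (1/(q−j)!)(R(t)(t+k)^{q−r})^{(q−j)}|_{t=−k}`. [cite: Zudilin2004, §8 Lemma 19 (proof)] -/
def Gk (k : ℕ) (t : ℚ) : ℚ :=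
  ((P.h 0 : ℚ) + 2 * t) *
    (∏ j ∈ Icc 1 P.r, polyBrick 1 (P.h j - 1) t) *
    (∏ j ∈ Icc 1 P.r, polyBrick ((P.h 0 - P.h j + 1 : ℕ) : ℤ) (P.h j - 1) t) *
    ∏ j ∈ Icc (P.r + 1) P.q, recipBrickReg (P.h j : ℤ) (P.h 0 - 2 * P.h j + 1) (k : ℤ) t

/-- Away from `t = −k`: `Gk P k t = R(t) (t+k)^{q−r}`. [cite: Zudilin2004, §8 Lemma 19 (proof)] -/
theorem Gk_eq (k : ℕ) {t : ℚ} (ht : t + k ≠ 0) : P.Gk k t = P.RwpQ t * (t + k) ^ (P.q - P.r) := by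
  rw [Gk, RwpQ_eq_bricks]
  have h : ∀ j ∈ Icc (P.r + 1) P.q, recipBrickReg (P.h j : ℤ) (P.h 0 - 2 * P.h j + 1) (k : ℤ) t
      = recipBrick (P.h j : ℤ) (P.h 0 - 2 * P.h j + 1) t * (t + k) := fun j _ => by
    rw [recipBrickReg_eq _ _ _ (by exact_mod_cast ht)]
    push_cast
    ring
  rw [prod_congr rfl h, prod_mul_distrib, prod_const, Nat.card_Icc,
    show P.q + 1 - (P.r + 1) = P.q - P.r by omega]
  ring

/-! ### (8.10): `D_{m₀}`-integrality of the Taylor coefficients at a pole -/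

variable {P}

/-- The linear factor `h₀ + 2t` has integral Taylor coefficients at every integer point. [cite: Zudilin2004, §8 Lemma 19 (proof)] -/
theorem isDInt_wpFactor (d N : ℕ) (k : ℕ) : IsDInt d N (fun t : ℚ => (P.h 0 : ℚ) + 2 * t) (-(k : ℚ)) := by
  have h := IsDInt.linear d N 2 (P.h 0) (-(k : ℤ))
  push_cast at h
  exact h.congr (Eventually.of_forall fun t => by ring)

/-- Lemma 15 for the bricks `R(h_j,1;t)`, `j ≤ r`, with modulus `D_{m₀}` (`h_j − 1 ≤ h_r − 1 ≤ m₀`).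
[cite: Zudilin2004, §7 Lemma 15, §8 (8.10)] -/
theorem isDInt_polyBricks₁ (hV : P.Valid) (N : ℕ) (k : ℕ) :
    IsDInt (Nat.lcmUpto P.m0) N (fun t => ∏ j ∈ Icc 1 P.r, polyBrick 1 (P.h j - 1) t) (-(k : ℚ)) := by
  have hrq := hV.r_add_four_le
  refine IsDInt.prod _ fun j hj => ?_
  have hj' := mem_Icc.1 hj
  have h0 := polyBrick_isDInt_neg (1 : ℤ) (P.h j - 1) (k : ℤ) N
  rw [Int.cast_natCast] at h0
  refine h0.of_dvd (lcmUpto_dvd_lcmUpto ?_)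
  have := hV.h_mono hj'.1 hj'.2 (by omega)
  simp only [m0]
  omega

/-- Lemma 15 for the bricks `R(h₀,h₀−h_j+1;t)`, `j ≤ r`, with modulus `D_{m₀}`. [cite: Zudilin2004, §7 Lemma 15, §8 (8.10)] -/
theorem isDInt_polyBricks₂ (hV : P.Valid) (N : ℕ) (k : ℕ) :
    IsDInt (Nat.lcmUpto P.m0) N
      (fun t => ∏ j ∈ Icc 1 P.r, polyBrick ((P.h 0 - P.h j + 1 : ℕ) : ℤ) (P.h j - 1) t) (-(k : ℚ)) := by
  have hrq := hV.r_add_four_le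
  refine IsDInt.prod _ fun j hj => ?_
  have hj' := mem_Icc.1 hj
  have h0 := polyBrick_isDInt_neg (((P.h 0 - P.h j + 1 : ℕ) : ℤ)) (P.h j - 1) (k : ℤ) N
  rw [Int.cast_natCast] at h0
  refine h0.of_dvd (lcmUpto_dvd_lcmUpto ?_)
  have := hV.h_mono hj'.1 hj'.2 (by omega)
  simp only [m0]
  omega

/-- Lemma 16 for the regularised reciprocal bricks `R(h_j,h₀−h_j+1;t)(t+k)`, `j > r`, at `h_{r+1} ≤ k ≤ h₀−h_{r+1}`,
with modulus `D_{m₀}` (`a₀ = h_{r+1}`, `b₀ = h₀−h_{r+1}+1`, `b₀−a₀−1 = h₀−2h_{r+1} ≤ m₀`).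
[cite: Zudilin2004, §7 Lemma 16, §8 (8.10)] -/
theorem isDInt_recipBricks (hV : P.Valid) {k : ℕ} (hk₁ : P.h (P.r + 1) ≤ k) (hk₂ : k ≤ P.h 0 - P.h (P.r + 1))
    (N : ℕ) :
    IsDInt (Nat.lcmUpto P.m0) N
      (fun t => ∏ j ∈ Icc (P.r + 1) P.q, recipBrickReg (P.h j : ℤ) (P.h 0 - 2 * P.h j + 1) (k : ℤ) t)
      (-(k : ℚ)) := by
  have hrq := hV.r_add_four_le
  have h2r : 2 * P.h (P.r + 1) < P.h 0 := hV.two_mul_h_lt (by omega) (by omega)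
  refine IsDInt.prod _ fun j hj => ?_
  have hj' := mem_Icc.1 hj
  have h2j : 2 * P.h j < P.h 0 := hV.two_mul_h_lt (by omega) hj'.2
  have hjr : P.h (P.r + 1) ≤ P.h j := hV.h_mono (by omega) hj'.1 hj'.2
  have h := recipBrickReg_isDInt (a₀ := (P.h (P.r + 1) : ℤ)) (b₀ := (P.h 0 : ℤ) - P.h (P.r + 1) + 1)
    (a := (P.h j : ℤ)) (m := P.h 0 - 2 * P.h j + 1) (k := (k : ℤ)) (by omega) (by exact_mod_cast hjr)
    (by omega) (by exact_mod_cast hk₁) (by omega) N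
  have e : ((P.h 0 : ℤ) - P.h (P.r + 1) + 1 - P.h (P.r + 1) - 1).toNat = P.h 0 - 2 * P.h (P.r + 1) := by
    omega
  rw [e, Int.cast_natCast] at h
  exact h.of_dvd (lcmUpto_dvd_lcmUpto (by simp only [m0]; omega))

/-- **(8.10)** ([Zudilin2004, proof of Lemma 19]): for `h_{r+1} ≤ k ≤ h₀ − h_{r+1}` the Taylor coefficients of
`R(t)(t+k)^{q−r}` at `t = −k` satisfy `D_{m₀}^j · (1/j!)(R(t)(t+k)^{q−r})^{(j)}|_{t=−k} ∈ ℤ` for all `j`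
(`m₀ = max{h_r − 1, h₀ − 2h_{r+1}}`), by the Leibniz rule from Lemmas 15 and 16. [cite: Zudilin2004, §8 (8.10)] -/
theorem Gk_isDInt (hV : P.Valid) {k : ℕ} (hk₁ : P.h (P.r + 1) ≤ k) (hk₂ : k ≤ P.h 0 - P.h (P.r + 1)) (N : ℕ) :
    IsDInt (Nat.lcmUpto P.m0) N (P.Gk k) (-(k : ℚ)) := by
  have h := (((isDInt_wpFactor (P := P) (Nat.lcmUpto P.m0) N k).mul (isDInt_polyBricks₁ hV N k)).mul
    (isDInt_polyBricks₂ hV N k)).mul (isDInt_recipBricks hV hk₁ hk₂ N)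
  exact h.congr (Eventually.of_forall fun t => rfl)

/-- `Gk P k` is smooth at `t = −k` (`h_{r+1} ≤ k ≤ h₀ − h_{r+1}`). [cite: Zudilin2004, §8 Lemma 19 (proof)] -/
theorem contDiffAt_Gk (hV : P.Valid) {k : ℕ} (hk₁ : P.h (P.r + 1) ≤ k) (hk₂ : k ≤ P.h 0 - P.h (P.r + 1))
    (N : ℕ) : ContDiffAt ℚ N (P.Gk k) (-(k : ℚ)) :=
  (Gk_isDInt hV hk₁ hk₂ N).contDiffAt

/-- (8.10) unfolded: `D_{m₀}^j · B ∈ ℤ` for the `j`-th divided derivative of `Gk P k` at `−k`.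
[cite: Zudilin2004, §8 (8.10)] -/
theorem exists_int_lcm_pow_mul_divDeriv_Gk (hV : P.Valid) {k : ℕ} (hk₁ : P.h (P.r + 1) ≤ k)
    (hk₂ : k ≤ P.h 0 - P.h (P.r + 1)) (j : ℕ) :
    ∃ z : ℤ, (Nat.lcmUpto P.m0 : ℚ) ^ j * divDeriv j (P.Gk k) (-(k : ℚ)) = z :=
  (Gk_isDInt hV hk₁ hk₂ j).isInt j le_rfl

end HParams

end Literature.NumberTheory.Irrationality.Zudilin2004
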